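import Summits.KontsevichZagierPeriods.KontsevichZagierPeriods.Theorems.UnfoldedStokesStokesGenerationFibrewiseRungScalingSwaps
import Mathlib.Analysis.Calculus.Deriv.Pi

/-!
# `StokesGeneration` (stmt-KontsevichZagierPeriods-3586) — line `fibrewise_stokes`, stub `stub_sectorDecomposition` (rung 27)

Registered rung stub SD (wave 7) of the line `fibrewise_stokes` of the crux `StokesGeneration` (route UnfoldedStokes):
**the sector decomposition `[0,1]^{N+1} = ⋃_j {x_j maximal}` is absorbed by S2's economy** (`FibStokesDecomposable`,
`Theorems/UnfoldedStokesDefs.lean`): for `f` `ℚ`-semialgebraic and `C¹` on an open `U ⊇ [0,1]^{N+1}`, the relator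
`f(x) − Σ_j x_j^N · f(x_j • x[j ↦ 1])` (each pyramid parametrised by the cube through the blow-down `y ↦ y_j · y[j ↦ 1]`,
Jacobian `y_j^N`, which collapses the face `{y_j = 0}` to the apex — so the face-preserving rungs 13–15 do not apply) is
fibrewise-Stokes decomposable; at `N + 1 = 2` this is Kuhn's subdivision `f(s,t) ≡ s f(s,st) + t f(ts,t)` (the shuffle).

Proof sketch (transcendence-free, value-free). On `[0,1]^{N+2}` (`x` along `Fin.castSucc`, `r` the last coordinate) the
RADIAL SCALING HOMOTOPY towards the apex gives `N + 2` hand-built elements (`sector_radialElements`): `G = −r^{N+1} f(rx)`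
along `r` and `G_j = r^N x_j f(rx)` along `x_j`; by Euler's identity `∂_r[r^{N+1} f(rx)] = Σ_j ∂_{x_j}[r^N x_j f(rx)]` the
fibre derivatives cancel identically and the faces leave `f(x) − Σ_j r^N f(r · x[j ↦ 1])`. Each pyramid term
`p_j(y) = y_j^N f(y_j • y[j ↦ 1])` read at `y = x[j ↦ r]` is moved back to the slot `j` by rung 11
(`fibStokesDecomposable_moveCoord`, `sector_pyramidMove`); subtract and un-pad. The fibre derivatives are the chain rule
along radial and coordinate lines; the partial derivatives `y ↦ Df(y) e_l` are `ℚ`-semialgebraic by Basu–Pollack–Roy,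
Prop. 3.22 (`IsSemialgebraicFunOn.fderiv_apply_single`).

References: M. Kontsevich, D. Zagier, *Periods* (2001), §1.2 rules (2), (3); J. Ayoub, Ann. of Math. 181 (2015),
Rem. 1.5; S. Basu, R. Pollack, M.-F. Roy, *Algorithms in Real Algebraic Geometry* (2006), Prop. 3.22.
-/

noncomputable section

-- `Summit.KontsevichZagierPeriods.KontsevichZagierPeriods.…` is the tree's mandated layout (single-conjunct summit).
set_option linter.dupNamespace false

namespace Summit.KontsevichZagierPeriods.KontsevichZagierPeriods.Cruxes.StokesGeneration.FibrewiseStokes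

open MeasureTheory Set
open Literature.NumberTheory.Transcendental
open Literature.NumberTheory.Transcendental.KZ
open Literature.ModelTheory.ExponentialFields (IsSemialgebraic)

/-- The chain rule along the radial line: `d/ds [s^m f(s • x)] = m s^{m-1} f(sx) + s^m Σ_l x_l ∂_l f(sx)`. [folklore] -/
private theorem sector_hasDerivAt_radial {n : ℕ} {f : (Fin n → ℝ) → ℝ} (x : Fin n → ℝ) (m : ℕ) (r : ℝ)
    (hfx : DifferentiableAt ℝ f (r • x)) :
    HasDerivAt (fun s : ℝ => s ^ m * f (s • x))
      ((m : ℝ) * r ^ (m - 1) * f (r • x) + r ^ m * ∑ l, x l * fderiv ℝ f (r • x) (Pi.single l 1)) r := by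
  have hlin : HasDerivAt (fun s : ℝ => s • x) x r := by
    simpa only [one_smul] using (hasDerivAt_id' r).smul_const x
  have hcomp : HasDerivAt (fun s : ℝ => f (s • x)) (fderiv ℝ f (r • x) x) r :=
    hfx.hasFDerivAt.comp_hasDerivAt_of_eq r hlin rfl
  have hx : x = ∑ i, x i • (Pi.single i (1:ℝ) : Fin n → ℝ) := pi_eq_sum_univ' x
  have hsum : fderiv ℝ f (r • x) x = ∑ l, x l * fderiv ℝ f (r • x) (Pi.single l 1) := by
    calc fderiv ℝ f (r • x) x = fderiv ℝ f (r • x) (∑ i, x i • (Pi.single i (1:ℝ) : Fin n → ℝ)) := by rw [← hx]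
      _ = ∑ l, x l * fderiv ℝ f (r • x) (Pi.single l 1) := by
          rw [map_sum]; simp only [map_smul, smul_eq_mul]
  rw [← hsum]
  exact (hasDerivAt_pow m r).mul hcomp

/-- The chain rule along a scaled coordinate line: `d/ds [f(r • x[j ↦ s])] = r ∂_j f(r x)` at `s = x_j`. [folklore] -/
private theorem sector_hasDerivAt_line {n : ℕ} {f : (Fin n → ℝ) → ℝ} (x : Fin n → ℝ) (j : Fin n) (r : ℝ)
    (hfx : DifferentiableAt ℝ f (r • x)) :
    HasDerivAt (fun s : ℝ => f (r • Function.update x j s)) (r * fderiv ℝ f (r • x) (Pi.single j 1)) (x j) := by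
  have hγ : HasDerivAt (fun s : ℝ => r • Function.update x j s) (r • (Pi.single j (1:ℝ) : Fin n → ℝ)) (x j) :=
    (hasDerivAt_update x j (x j)).const_smul r
  have hpt : r • x = r • Function.update x j (x j) := by rw [Function.update_eq_self]
  have key := hfx.hasFDerivAt.comp_hasDerivAt_of_eq (x j) hγ hpt
  simpa only [Function.comp_def, map_smul, smul_eq_mul] using key

/-- Scaling a point of the closed unit cube by a factor in `[0,1]` stays in the cube. [folklore] -/
private theorem sector_smul_mem_cubePi {n : ℕ} {r : ℝ} (hr : r ∈ Set.Icc (0:ℝ) 1) {x : Fin n → ℝ}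
    (hx : x ∈ Set.pi Set.univ (fun _ : Fin n => Set.Icc (0:ℝ) 1)) :
    r • x ∈ Set.pi Set.univ (fun _ : Fin n => Set.Icc (0:ℝ) 1) :=
  Set.mem_univ_pi.mpr fun l => by
    have hl := (Set.mem_univ_pi.mp hx) l
    simp only [Pi.smul_apply, smul_eq_mul]
    exact ⟨mul_nonneg hr.1 hl.1, mul_le_one₀ hr.2 hl.1 hl.2⟩

/-- **The radial elements.** For `f` `ℚ`-semialgebraic and `C¹` on an open `U ⊇ [0,1]^{N+1}`, on the padded cube
`[0,1]^{N+2}` (`x` along `Fin.castSucc`, `r` last) `f(x) − Σ_j r^N f(r • x[j ↦ 1])` is fibrewise-Stokes decomposable: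
`G = −r^{N+1} f(rx)` along `r` and `G_j = r^N x_j f(rx)` along `x_j`; the fibre derivatives cancel by Euler's identity
`∂_r[r^{N+1} f(rx)] = Σ_j ∂_{x_j}[r^N x_j f(rx)]`, the faces are `−f(x) + 0`, `r^N f(r • x[j ↦ 1]) − 0`.
[cite: KontsevichZagier2001, §1.2 rules (2), (3)] -/
theorem sector_radialElements {N : ℕ} (U : Set (Fin (N + 1) → ℝ)) (hU : IsOpen U)
    (hCU : Set.pi Set.univ (fun _ : Fin (N + 1) => Set.Icc (0:ℝ) 1) ⊆ U) (f : (Fin (N + 1) → ℝ) → ℝ)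
    (hf : IsSemialgebraicFunOn ℚ U f) (hfd : ContDiffOn ℝ 1 f U) :
    FibStokesDecomposable (N + 1 + 1) (fun z => f (fun l => z (Fin.castSucc l)) -
      ∑ j : Fin (N + 1), z (Fin.last (N + 1)) ^ N *
        f (z (Fin.last (N + 1)) • Function.update (fun l => z (Fin.castSucc l)) j 1)) := by
  classical
  set C : Set (Fin (N + 1) → ℝ) := Set.pi Set.univ (fun _ : Fin (N + 1) => Set.Icc (0:ℝ) 1) with hC
  set C' : Set (Fin (N + 1 + 1) → ℝ) := Set.pi Set.univ (fun _ : Fin (N + 1 + 1) => Set.Icc (0:ℝ) 1) with hC'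
  have hC'sa : IsSemialgebraic ℚ C' := by rw [hC', ← cube_eq_pi]; exact isSemialgebraic_cube
  have hC'c : IsCompact C' := isCompact_univ_pi fun _ => isCompact_Icc
  have hmem : ∀ z ∈ C', ∀ i, z i ∈ Set.Icc (0:ℝ) 1 := fun z hz i => (Set.mem_univ_pi.mp hz) i
  have hproj : ∀ z ∈ C', (fun l => z (Fin.castSucc l)) ∈ C := fun z hz =>
    Set.mem_univ_pi.mpr fun l => (Set.mem_univ_pi.mp hz) (Fin.castSucc l)
  have hupd : ∀ z ∈ C', ∀ (i : Fin (N + 1 + 1)), ∀ s ∈ Set.Icc (0:ℝ) 1, Function.update z i s ∈ C' :=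
    fun z hz i s hs => update_mem_cubePi hz i hs
  have h0I : (0:ℝ) ∈ Set.Icc (0:ℝ) 1 := ⟨le_rfl, zero_le_one⟩
  have h1I : (1:ℝ) ∈ Set.Icc (0:ℝ) 1 := ⟨zero_le_one, le_rfl⟩
  have hdiff : ∀ y ∈ U, DifferentiableAt ℝ f y := fun y hy =>
    (hfd.contDiffAt (hU.mem_nhds hy)).differentiableAt one_ne_zero
  obtain ⟨fd, hfdef⟩ : ∃ fd : Fin (N + 1) → (Fin (N + 1) → ℝ) → ℝ,
      fd = fun l y => fderiv ℝ f y (Pi.single l 1) := ⟨_, rfl⟩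
  have hfdsa : ∀ l, IsSemialgebraicFunOn ℚ U (fd l) := fun l => by
    rw [hfdef]; exact hf.fderiv_apply_single hU hdiff l
  have hfdc : ∀ l, ContinuousOn (fd l) U := fun l => by
    rw [hfdef]; exact (hfd.continuousOn_fderiv_of_isOpen hU le_rfl).clm_apply continuousOn_const
  -- the scaling map `S z = r • x`
  obtain ⟨S, hS⟩ : ∃ S : (Fin (N + 1 + 1) → ℝ) → (Fin (N + 1) → ℝ),
      S = fun z => z (Fin.last (N + 1)) • fun l => z (Fin.castSucc l) := ⟨_, rfl⟩
  have hSz : ∀ z, S z = z (Fin.last (N + 1)) • fun l => z (Fin.castSucc l) := fun z => by rw [hS]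
  have hSU : Set.MapsTo S C' U := fun z hz =>
    hCU (by rw [hSz]; exact sector_smul_mem_cubePi (hmem z hz _) (hproj z hz))
  have hSsa : IsSemialgebraicMapOn ℚ C' S := IsSemialgebraicMapOn.of_forall hC'sa fun l =>
    ((isSemialgebraicFunOn_apply hC'sa (Fin.last (N + 1))).fun_mul
      (isSemialgebraicFunOn_apply hC'sa (Fin.castSucc l))).congr fun z _ => by simp [hSz]
  have hScont : Continuous S := by
    rw [hS]
    exact (continuous_apply (Fin.last (N + 1))).smul (continuous_pi fun l => continuous_apply (Fin.castSucc l))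
  have hfS : IsSemialgebraicFunOn ℚ C' (fun z => f (S z)) :=
    IsSemialgebraicFunOn.comp_isSemialgebraicMapOn_holds hf hSsa hSU
  have hfdS : ∀ l, IsSemialgebraicFunOn ℚ C' (fun z => fd l (S z)) := fun l =>
    IsSemialgebraicFunOn.comp_isSemialgebraicMapOn_holds (hfdsa l) hSsa hSU
  have hfSc : ContinuousOn (fun z => f (S z)) C' := hfd.continuousOn.comp hScont.continuousOn hSU
  have hfdSc : ∀ l, ContinuousOn (fun z => fd l (S z)) C' := fun l => (hfdc l).comp hScont.continuousOn hSU
  have hr : IsSemialgebraicFunOn ℚ C' (fun z => z (Fin.last (N + 1))) := isSemialgebraicFunOn_apply hC'sa _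
  have hx : ∀ l : Fin (N + 1), IsSemialgebraicFunOn ℚ C' (fun z => z (Fin.castSucc l)) := fun l => isSemialgebraicFunOn_apply hC'sa _
  have hrc : Continuous fun z : Fin (N + 1 + 1) → ℝ => z (Fin.last (N + 1)) := continuous_apply _
  -- readings of `S` on the fibres
  have hS_last : ∀ (z : Fin (N + 1 + 1) → ℝ) (c : ℝ),
      S (Function.update z (Fin.last (N + 1)) c) = c • fun l => z (Fin.castSucc l) := by
    intro z c; rw [hS]; funext l; simp
  have hS_cs : ∀ (z : Fin (N + 1 + 1) → ℝ) (j : Fin (N + 1)) (c : ℝ),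
      S (Function.update z (Fin.castSucc j) c) =
        z (Fin.last (N + 1)) • Function.update (fun l => z (Fin.castSucc l)) j c := by
    intro z j c; rw [hS]; funext l
    simp only [Pi.smul_apply, Function.update_of_ne (Fin.castSucc_lt_last j).ne']
    rcases eq_or_ne l j with rfl | hlj
    · simp
    · simp [Function.update_of_ne hlj, Function.update_of_ne ((Fin.castSucc_injective _).ne hlj)]
  -- the witnesses: the radial element and the `N + 1` coordinate elements
  obtain ⟨Gl, hGl⟩ : ∃ Gl : (Fin (N + 1 + 1) → ℝ) → ℝ,
      Gl = fun z => -(z (Fin.last (N + 1)) ^ (N + 1) * f (S z)) := ⟨_, rfl⟩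
  obtain ⟨Dl, hDl⟩ : ∃ Dl : (Fin (N + 1 + 1) → ℝ) → ℝ, Dl = fun z =>
      -(((N + 1 : ℕ) : ℝ) * z (Fin.last (N + 1)) ^ N * f (S z) +
        z (Fin.last (N + 1)) ^ (N + 1) * ∑ l, z (Fin.castSucc l) * fd l (S z)) := ⟨_, rfl⟩
  obtain ⟨Gj, hGj⟩ : ∃ Gj : Fin (N + 1) → (Fin (N + 1 + 1) → ℝ) → ℝ,
      Gj = fun j z => z (Fin.last (N + 1)) ^ N * z (Fin.castSucc j) * f (S z) := ⟨_, rfl⟩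
  obtain ⟨Dj, hDj⟩ : ∃ Dj : Fin (N + 1) → (Fin (N + 1 + 1) → ℝ) → ℝ, Dj = fun j z =>
      z (Fin.last (N + 1)) ^ N * (f (S z) + z (Fin.castSucc j) * (z (Fin.last (N + 1)) * fd j (S z))) :=
    ⟨_, rfl⟩
  have hGlsa : IsSemialgebraicFunOn ℚ C' Gl := by rw [hGl]; exact ((hr.fun_pow (N + 1)).fun_mul hfS).fun_neg
  have hDlsa : IsSemialgebraicFunOn ℚ C' Dl := by
    rw [hDl]
    exact ((((isSemialgebraicFunOn_const_natCast hC'sa _).fun_mul (hr.fun_pow N)).fun_mul hfS).fun_add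
      ((hr.fun_pow (N + 1)).fun_mul (IsSemialgebraicFunOn.fun_finsetSum Finset.univ hC'sa fun l _ =>
        (hx l).fun_mul (hfdS l)))).fun_neg
  have hGjsa : ∀ j, IsSemialgebraicFunOn ℚ C' (Gj j) := fun j => by
    rw [hGj]; exact ((hr.fun_pow N).fun_mul (hx j)).fun_mul hfS
  have hDjsa : ∀ j, IsSemialgebraicFunOn ℚ C' (Dj j) := fun j => by
    rw [hDj]; exact (hr.fun_pow N).fun_mul (hfS.fun_add ((hx j).fun_mul (hr.fun_mul (hfdS j))))
  have hGlc : ContinuousOn Gl C' := by rw [hGl]; exact ((hrc.pow (N + 1)).continuousOn.mul hfSc).neg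
  have hDlc : ContinuousOn Dl C' := by
    rw [hDl]
    exact (((continuous_const.mul (hrc.pow N)).continuousOn.mul hfSc).add ((hrc.pow (N + 1)).continuousOn.mul
      (continuousOn_finsetSum Finset.univ fun l _ => (continuous_apply _).continuousOn.mul (hfdSc l)))).neg
  have hGjc : ∀ j, ContinuousOn (Gj j) C' := fun j => by
    rw [hGj]; exact ((hrc.pow N).mul (continuous_apply _)).continuousOn.mul hfSc
  have hDjc : ∀ j, ContinuousOn (Dj j) C' := fun j => by
    rw [hDj]
    exact (hrc.pow N).continuousOn.mul (hfSc.add ((continuous_apply _).continuousOn.mul (hrc.continuousOn.mul (hfdSc j))))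
  have hface_sa : ∀ {F : (Fin (N + 1 + 1) → ℝ) → ℝ}, IsSemialgebraicFunOn ℚ C' F → ∀ (i : Fin (N + 1 + 1)) (t : ℝ),
      IsAlgebraic ℚ t → t ∈ Set.Icc (0:ℝ) 1 → IsSemialgebraicFunOn ℚ C' (fun x => F (Function.update x i t)) :=
    fun hF i t ht htI => IsSemialgebraicFunOn.comp_isSemialgebraicMapOn_holds hF
      (isSemialgebraicMapOn_update_const i ht) fun x hx => hupd x hx i t htI
  have hface_c : ∀ {F : (Fin (N + 1 + 1) → ℝ) → ℝ}, ContinuousOn F C' → ∀ (i : Fin (N + 1 + 1)) (t : ℝ),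
      t ∈ Set.Icc (0:ℝ) 1 → ContinuousOn (fun x => F (Function.update x i t)) C' :=
    fun hF i t htI => hF.comp (continuous_id.update i continuous_const).continuousOn fun x hx => hupd x hx i t htI
  have hbound : ∀ {F : (Fin (N + 1 + 1) → ℝ) → ℝ}, ContinuousOn F C' → ∃ B : ℝ, ∀ x ∈ C', |F x| ≤ B :=
    fun hF => by
      obtain ⟨B, hB⟩ := hC'c.exists_bound_of_continuousOn hF
      exact ⟨B, fun x hx => by simpa [Real.norm_eq_abs] using hB x hx⟩
  have hcu : ∀ (x : Fin (N + 1 + 1) → ℝ) (i : Fin (N + 1 + 1)), Continuous fun s : ℝ => Function.update x i s :=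
    fun x i => continuous_const.update i continuous_id
  obtain ⟨Il, hIl⟩ : ∃ Il : (Fin (N + 1 + 1) → ℝ) → ℝ, Il = fun z =>
      Dl z - (Gl (Function.update z (Fin.last (N + 1)) 1) - Gl (Function.update z (Fin.last (N + 1)) 0)) :=
    ⟨_, rfl⟩
  obtain ⟨Ij, hIj⟩ : ∃ Ij : Fin (N + 1) → (Fin (N + 1 + 1) → ℝ) → ℝ, Ij = fun j z =>
      Dj j z - (Gj j (Function.update z (Fin.castSucc j) 1) - Gj j (Function.update z (Fin.castSucc j) 0)) :=
    ⟨_, rfl⟩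
  have hIlsa : IsSemialgebraicFunOn ℚ C' Il := by
    rw [hIl]
    exact hDlsa.fun_sub ((hface_sa hGlsa _ 1 isAlgebraic_one h1I).fun_sub (hface_sa hGlsa _ 0 isAlgebraic_zero h0I))
  have hIlc : ContinuousOn Il C' := by
    rw [hIl]; exact hDlc.sub ((hface_c hGlc _ 1 h1I).sub (hface_c hGlc _ 0 h0I))
  have hIjsa : ∀ j, IsSemialgebraicFunOn ℚ C' (Ij j) := fun j => by
    rw [hIj]
    exact (hDjsa j).fun_sub ((hface_sa (hGjsa j) _ 1 isAlgebraic_one h1I).fun_sub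
      (hface_sa (hGjsa j) _ 0 isAlgebraic_zero h0I))
  have hIjc : ∀ j, ContinuousOn (Ij j) C' := fun j => by
    rw [hIj]; exact (hDjc j).sub ((hface_c (hGjc j) _ 1 h1I).sub (hface_c (hGjc j) _ 0 h0I))
  obtain ⟨ql, hqld, hqli⟩ := exists_cubeRep (N + 1 + 1) Il hIlsa hIlc
  have hq : ∀ j, ∃ q : IntegralRep (N + 1 + 1), q.domain = C' ∧ q.integrand = Ij j := fun j =>
    exists_cubeRep (N + 1 + 1) (Ij j) (hIjsa j) (hIjc j)
  choose q hqd hqi using hq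
  -- the radial element is decomposable
  have hdec1 : FibStokesDecomposable (N + 1 + 1)
      (fun z => ∑ j : Fin 1, ((fun _ : Fin 1 => ql) j).integrand z) := by
    refine fibStokesDecomposable_of_elements (M := N + 1 + 1) (J := 1) (fun _ => Fin.last (N + 1))
      (fun _ => Gl) (fun _ => Dl) (fun _ => ql) (fun _ => ?_) (fun _ => ⟨hqld, fun z _ => by rw [hqli, hIl]⟩)
    refine ⟨hGlsa, hDlsa, hbound hGlc, fun z hz => ?_, fun z hz _ => ?_⟩
    · exact hGlc.comp (hcu z _).continuousOn fun s hs => hupd z hz _ s hs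
    · show HasDerivAt (fun s : ℝ => Gl (Function.update z (Fin.last (N + 1)) s)) (Dl z) (z (Fin.last (N + 1)))
      have hfun : (fun s : ℝ => Gl (Function.update z (Fin.last (N + 1)) s)) =
          fun s => -(s ^ (N + 1) * f (s • fun l => z (Fin.castSucc l))) := by
        funext s; rw [hGl]; simp only [Function.update_self, hS_last]
      rw [hfun]
      have hxU : z (Fin.last (N + 1)) • (fun l => z (Fin.castSucc l)) ∈ U := by rw [← hSz]; exact hSU hz
      refine (sector_hasDerivAt_radial (fun l => z (Fin.castSucc l)) (N + 1) (z (Fin.last (N + 1)))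
        (hdiff _ hxU)).neg.congr_deriv ?_
      rw [hDl]; simp only [Nat.add_sub_cancel, hSz, hfdef]
  -- the coordinate elements are decomposable
  have hdec2 : FibStokesDecomposable (N + 1 + 1) (fun z => ∑ j, (q j).integrand z) := by
    refine fibStokesDecomposable_of_elements (M := N + 1 + 1) (J := N + 1) Fin.castSucc Gj Dj q (fun j => ?_)
      (fun j => ⟨hqd j, fun z _ => by rw [hqi j, hIj]⟩)
    refine ⟨hGjsa j, hDjsa j, hbound (hGjc j), fun z hz => ?_, fun z hz _ => ?_⟩
    · exact (hGjc j).comp (hcu z _).continuousOn fun s hs => hupd z hz _ s hs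
    · show HasDerivAt (fun s : ℝ => Gj j (Function.update z (Fin.castSucc j) s)) (Dj j z) (z (Fin.castSucc j))
      have hfun : (fun s : ℝ => Gj j (Function.update z (Fin.castSucc j) s)) = fun s =>
          z (Fin.last (N + 1)) ^ N *
            (s * f (z (Fin.last (N + 1)) • Function.update (fun l => z (Fin.castSucc l)) j s)) := by
        funext s; rw [hGj]
        simp only [Function.update_self, Function.update_of_ne (Fin.castSucc_lt_last j).ne', hS_cs]; ring
      rw [hfun]
      have hxU : z (Fin.last (N + 1)) • (fun l => z (Fin.castSucc l)) ∈ U := by rw [← hSz]; exact hSU hz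
      have key := ((hasDerivAt_id' (z (Fin.castSucc j))).mul
        (sector_hasDerivAt_line (fun l => z (Fin.castSucc l)) j (z (Fin.last (N + 1))) (hdiff _ hxU))).const_mul
        (z (Fin.last (N + 1)) ^ N)
      refine key.congr_deriv ?_
      rw [hDj]; simp only [Function.update_eq_self, hSz, hfdef, one_mul]
  -- the fibre derivatives cancel (Euler's identity)
  have hsumD : ∀ z, ∑ j, Dj j z + Dl z = 0 := by
    intro z
    have h1 : ∀ j, Dj j z = z (Fin.last (N + 1)) ^ N * f (S z) +
        z (Fin.last (N + 1)) ^ (N + 1) * (z (Fin.castSucc j) * fd j (S z)) := fun j => by rw [hDj]; ring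
    simp only [h1, Finset.sum_add_distrib, Finset.sum_const, Finset.card_univ, Fintype.card_fin, nsmul_eq_mul,
      ← Finset.mul_sum]
    rw [hDl]; push_cast; ring
  have h0pow : (0:ℝ) ^ (N + 1) = 0 := by simp
  have hface0 : ∀ z, Gl (Function.update z (Fin.last (N + 1)) 1) - Gl (Function.update z (Fin.last (N + 1)) 0) =
      -f (fun l => z (Fin.castSucc l)) := by
    intro z; rw [hGl]
    simp only [Function.update_self, hS_last, one_pow, one_smul, one_mul, h0pow, zero_mul, neg_zero, sub_zero]
  have hfacej : ∀ z (j : Fin (N + 1)), Gj j (Function.update z (Fin.castSucc j) 1) -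
      Gj j (Function.update z (Fin.castSucc j) 0) =
      z (Fin.last (N + 1)) ^ N * f (z (Fin.last (N + 1)) • Function.update (fun l => z (Fin.castSucc l)) j 1) := by
    intro z j; rw [hGj]
    simp only [Function.update_self, Function.update_of_ne (Fin.castSucc_lt_last j).ne', hS_cs]; ring
  refine fibStokesDecomposable_congr_off_null (N + 1 + 1) _ _ ∅
    Literature.ModelTheory.ExponentialFields.isSemialgebraic_empty measure_empty (fun z _ _ => ?_)
    (fibStokesDecomposable_add _ _ _ hdec1 hdec2)
  simp only [Fin.sum_univ_one, hqli, hqi, hIl, hIj, hface0, hfacej]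
  rw [Finset.sum_sub_distrib]
  linarith [hsumD z]

/-- **The pyramid term moved to its slot.** For `f` `ℚ`-semialgebraic and `C¹` on an open `U ⊇ [0,1]^{N+1}` and a slot
`j`, the pyramid term `p_j(y) = y_j^N f(y_j • y[j ↦ 1])` gives a fibrewise-Stokes decomposable `p_j(x) − p_j(x[j ↦ r])`
on the padded cube `[0,1]^{N+2}` (`r` last): rung 11 (`fibStokesDecomposable_moveCoord`) for `p_j`, which is
`ℚ`-semialgebraic, continuous and `C¹` along `j` on the closed cube. [cite: KontsevichZagier2001, §1.2 rules (2), (3)] -/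
theorem sector_pyramidMove {N : ℕ} (U : Set (Fin (N + 1) → ℝ)) (hU : IsOpen U)
    (hCU : Set.pi Set.univ (fun _ : Fin (N + 1) => Set.Icc (0:ℝ) 1) ⊆ U) (f : (Fin (N + 1) → ℝ) → ℝ)
    (hf : IsSemialgebraicFunOn ℚ U f) (hfd : ContDiffOn ℝ 1 f U) (j : Fin (N + 1)) :
    FibStokesDecomposable (N + 1 + 1) (fun z =>
      z (Fin.castSucc j) ^ N * f (z (Fin.castSucc j) • Function.update (fun l => z (Fin.castSucc l)) j 1) -
      z (Fin.last (N + 1)) ^ N *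
        f (z (Fin.last (N + 1)) • Function.update (fun l => z (Fin.castSucc l)) j 1)) := by
  classical
  set C : Set (Fin (N + 1) → ℝ) := Set.pi Set.univ (fun _ : Fin (N + 1) => Set.Icc (0:ℝ) 1) with hC
  set C' : Set (Fin (N + 1 + 1) → ℝ) := Set.pi Set.univ (fun _ : Fin (N + 1 + 1) => Set.Icc (0:ℝ) 1) with hC'
  have hCsa : IsSemialgebraic ℚ C := by rw [hC, ← cube_eq_pi]; exact isSemialgebraic_cube
  have hC'sa : IsSemialgebraic ℚ C' := by rw [hC', ← cube_eq_pi]; exact isSemialgebraic_cube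
  have hproj : ∀ z ∈ C', (fun l => z (Fin.castSucc l)) ∈ C := fun z hz =>
    Set.mem_univ_pi.mpr fun l => (Set.mem_univ_pi.mp hz) (Fin.castSucc l)
  have hdiff : ∀ y ∈ U, DifferentiableAt ℝ f y := fun y hy =>
    (hfd.contDiffAt (hU.mem_nhds hy)).differentiableAt one_ne_zero
  have hfdc : ∀ l : Fin (N + 1), ContinuousOn (fun y => fderiv ℝ f y (Pi.single l 1)) U := fun l =>
    (hfd.continuousOn_fderiv_of_isOpen hU le_rfl).clm_apply continuousOn_const
  -- the blow-down `x ↦ x_j • x[j ↦ 1]` maps the cube into itself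
  have hTC : ∀ x ∈ C, x j • Function.update x j 1 ∈ C := fun x hx =>
    sector_smul_mem_cubePi ((Set.mem_univ_pi.mp hx) j) (update_mem_cubePi hx j ⟨zero_le_one, le_rfl⟩)
  have hTU : Set.MapsTo (fun x : Fin (N + 1) → ℝ => x j • Function.update x j 1) C U := fun x hx => hCU (hTC x hx)
  have hTsa : IsSemialgebraicMapOn ℚ C (fun x : Fin (N + 1) → ℝ => x j • Function.update x j 1) := by
    refine IsSemialgebraicMapOn.of_forall hCsa fun l => ?_
    by_cases hlj : l = j
    · exact (isSemialgebraicFunOn_apply hCsa j).congr fun x _ => by simp [hlj]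
    · exact ((isSemialgebraicFunOn_apply hCsa j).fun_mul (isSemialgebraicFunOn_apply hCsa l)).congr
        fun x _ => by simp [Function.update_of_ne hlj]
  have hTc : Continuous fun x : Fin (N + 1) → ℝ => x j • Function.update x j 1 :=
    (continuous_apply j).smul (continuous_id.update j continuous_const)
  have h1sa : ∀ l, IsSemialgebraicFunOn ℚ C (fun x => Function.update x j (1:ℝ) l) := fun l => by
    by_cases hlj : l = j
    · exact (isSemialgebraicFunOn_const_of_isAlgebraic hCsa isAlgebraic_one).congr fun x _ => by simp [hlj]
    · exact (isSemialgebraicFunOn_apply hCsa l).congr fun x _ => by simp [Function.update_of_ne hlj]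
  have h1c : ∀ l, Continuous fun x : Fin (N + 1) → ℝ => Function.update x j (1:ℝ) l := fun l =>
    (continuous_apply l).comp (continuous_id.update j continuous_const)
  have hfT : IsSemialgebraicFunOn ℚ C (fun x => f (x j • Function.update x j 1)) :=
    IsSemialgebraicFunOn.comp_isSemialgebraicMapOn_holds hf hTsa hTU
  have hfdT : ∀ l, IsSemialgebraicFunOn ℚ C
      (fun x => fderiv ℝ f (x j • Function.update x j 1) (Pi.single l 1)) := fun l =>
    IsSemialgebraicFunOn.comp_isSemialgebraicMapOn_holds (hf.fderiv_apply_single hU hdiff l) hTsa hTU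
  have hfTc : ContinuousOn (fun x => f (x j • Function.update x j 1)) C := hfd.continuousOn.comp hTc.continuousOn hTU
  have hfdTc : ∀ l, ContinuousOn (fun x => fderiv ℝ f (x j • Function.update x j 1) (Pi.single l 1)) C :=
    fun l => (hfdc l).comp hTc.continuousOn hTU
  -- the pyramid term `p` and its fibre derivative `pd` along `j`
  obtain ⟨p, hp⟩ : ∃ p : (Fin (N + 1) → ℝ) → ℝ, p = fun x => x j ^ N * f (x j • Function.update x j 1) :=
    ⟨_, rfl⟩
  obtain ⟨pd, hpd⟩ : ∃ pd : (Fin (N + 1) → ℝ) → ℝ, pd = fun x =>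
      (N : ℝ) * x j ^ (N - 1) * f (x j • Function.update x j 1) +
        x j ^ N * ∑ l, Function.update x j (1:ℝ) l * fderiv ℝ f (x j • Function.update x j 1) (Pi.single l 1) :=
    ⟨_, rfl⟩
  have hxj : IsSemialgebraicFunOn ℚ C (fun x => x j) := isSemialgebraicFunOn_apply hCsa j
  have hpsa : IsSemialgebraicFunOn ℚ C p := by rw [hp]; exact (hxj.fun_pow N).fun_mul hfT
  have hpdsa : IsSemialgebraicFunOn ℚ C pd := by
    rw [hpd]
    exact (((isSemialgebraicFunOn_const_natCast hCsa N).fun_mul (hxj.fun_pow (N - 1))).fun_mul hfT).fun_add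
      ((hxj.fun_pow N).fun_mul (IsSemialgebraicFunOn.fun_finsetSum Finset.univ hCsa fun l _ =>
        (h1sa l).fun_mul (hfdT l)))
  have hpc : ContinuousOn p C := by rw [hp]; exact ((continuous_apply j).pow N).continuousOn.mul hfTc
  have hpdc : ContinuousOn pd C := by
    rw [hpd]
    exact ((continuous_const.mul ((continuous_apply j).pow (N - 1))).continuousOn.mul hfTc).add
      (((continuous_apply j).pow N).continuousOn.mul (continuousOn_finsetSum Finset.univ fun l _ =>
        (h1c l).continuousOn.mul (hfdTc l)))
  have hread_sa : ∀ {g : (Fin (N + 1) → ℝ) → ℝ}, IsSemialgebraicFunOn ℚ C g →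
      IsSemialgebraicFunOn ℚ C' (fun z => g (fun l => z (Fin.castSucc l))) := fun hg =>
    (isSemialgebraicFunOn_comp_coord hg Fin.castSucc).mono (fun z hz => hproj z hz) hC'sa
  have hread_c : ∀ {g : (Fin (N + 1) → ℝ) → ℝ}, ContinuousOn g C →
      ContinuousOn (fun z => g (fun l => z (Fin.castSucc l))) C' := fun hg =>
    hg.comp (continuous_pi fun l => continuous_apply (Fin.castSucc l)).continuousOn fun z hz => hproj z hz
  have hproj_last : ∀ (z : Fin (N + 1 + 1) → ℝ) (c : ℝ),
      (fun l => Function.update z (Fin.last (N + 1)) c (Fin.castSucc l)) = fun l => z (Fin.castSucc l) := by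
    intro z c; funext l; rw [Function.update_of_ne (Fin.castSucc_lt_last l).ne]
  have hproj_cs : ∀ (z : Fin (N + 1 + 1) → ℝ) (c : ℝ),
      (fun l => Function.update z (Fin.castSucc j) c (Fin.castSucc l)) =
        Function.update (fun l => z (Fin.castSucc l)) j c := by
    intro z c; funext l
    rcases eq_or_ne l j with rfl | hlj
    · simp
    · rw [Function.update_of_ne ((Fin.castSucc_injective _).ne hlj), Function.update_of_ne hlj]
  have hmove := fibStokesDecomposable_moveCoord (Fin.castSucc j) (Fin.last (N + 1)) (Fin.castSucc_lt_last j).ne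
    (fun z => p (fun l => z (Fin.castSucc l))) (fun z => pd (fun l => z (Fin.castSucc l)))
    (hread_sa hpsa) (hread_sa hpdsa) (hread_c hpc) (hread_c hpdc)
    (fun z s => by simp only [hproj_last]) (fun z s => by simp only [hproj_last])
    (fun z hz _ => by
      show HasDerivAt (fun s : ℝ => p (fun l => Function.update z (Fin.castSucc j) s (Fin.castSucc l)))
        (pd (fun l => z (Fin.castSucc l))) (z (Fin.castSucc j))
      have hfun : (fun s : ℝ => p (fun l => Function.update z (Fin.castSucc j) s (Fin.castSucc l))) =
          fun s => s ^ N * f (s • Function.update (fun l => z (Fin.castSucc l)) j 1) := by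
        funext s; simp only [hproj_cs, hp, Function.update_self, Function.update_idem]
      rw [hfun]
      have hxU : z (Fin.castSucc j) • Function.update (fun l => z (Fin.castSucc l)) j 1 ∈ U := hTU (hproj z hz)
      refine (sector_hasDerivAt_radial (Function.update (fun l => z (Fin.castSucc l)) j 1) N
        (z (Fin.castSucc j)) (hdiff _ hxU)).congr_deriv ?_
      rw [hpd])
  refine fibStokesDecomposable_congr_off_null (N + 1 + 1) _ _ ∅
    Literature.ModelTheory.ExponentialFields.isSemialgebraic_empty measure_empty (fun z _ _ => ?_) hmove
  simp only [hproj_cs, hp, Function.update_self, Function.update_idem]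

/-- **Registered stub `stub_sectorDecomposition` (rung 27, SD): sector decomposition by the largest coordinate.**
For `f` `ℚ`-semialgebraic and `C¹` on an open `U ⊇ [0,1]^{N+1}`, the relator
`f(x) − Σ_j x_j^N · f((x_j • x)[j ↦ x_j])` (`(x_j • x)[j ↦ x_j]` = the point with coordinates `x_j x_i` for `i ≠ j`
and `x_j` at `j`: the pyramid `{x_j maximal}` parametrised by the cube, Jacobian `x_j^N`) is fibrewise-Stokes
decomposable on `[0,1]^{N+1}`: the radial elements on `[0,1]^{N+2}` (`sector_radialElements`) minus the moved
pyramid terms (`sector_pyramidMove`), un-padded; transcendence-free, value-free. [cite: KontsevichZagier2001, §1.2] -/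
theorem stub_sectorDecomposition {N : ℕ} (U : Set (Fin (N + 1) → ℝ)) (hU : IsOpen U)
    (hCU : Set.pi Set.univ (fun _ : Fin (N + 1) => Set.Icc (0:ℝ) 1) ⊆ U) (f : (Fin (N + 1) → ℝ) → ℝ)
    (hf : IsSemialgebraicFunOn ℚ U f) (hfd : ContDiffOn ℝ 1 f U) :
    FibStokesDecomposable (N + 1) (fun x => f x -
      ∑ j : Fin (N + 1), x j ^ N * f (Function.update (x j • x) j (x j))) := by
  have hA := sector_radialElements U hU hCU f hf hfd
  have hB := fibStokesDecomposable_finsetSum Finset.univ _ fun j _ => sector_pyramidMove U hU hCU f hf hfd j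
  have hle : N + 1 ≤ N + 1 + 1 := (N + 1).le_succ
  refine fibStokesDecomposable_unpad hle _ (fibStokesDecomposable_congr_off_null (N + 1 + 1) _ _ ∅
    Literature.ModelTheory.ExponentialFields.isSemialgebraic_empty measure_empty (fun z _ _ => ?_)
    (fibStokesDecomposable_sub _ _ _ hA hB))
  have hupd : ∀ l : Fin (N + 1), Function.update (z (Fin.castSucc l) • fun i => z (Fin.castSucc i)) l
      (z (Fin.castSucc l)) = z (Fin.castSucc l) • Function.update (fun i => z (Fin.castSucc i)) l 1 := by
    intro l; funext i
    rcases eq_or_ne i l with rfl | hil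
    · simp
    · simp [Function.update_of_ne hil]
  simp only [show ∀ l : Fin (N + 1), z (Fin.castLE hle l) = z (Fin.castSucc l) from fun l => rfl, hupd]
  rw [Finset.sum_sub_distrib]
  ring

end Summit.KontsevichZagierPeriods.KontsevichZagierPeriods.Cruxes.StokesGeneration.FibrewiseStokes

end
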